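import Summits.ResolutionOfSingularities.ResolutionOfSingularities.Theorems.PAlterationAssembly2
import Literature.AlgebraicGeometry.Resolution.ResolutionOfSingularities
import Mathlib.FieldTheory.PurelyInseparable.Basic
import Mathlib.RingTheory.FiniteType
import Mathlib.RingTheory.Localization.FractionRing
import Mathlib.AlgebraicGeometry.Morphisms.Finite
import Mathlib.AlgebraicGeometry.Morphisms.UniversallyInjective
import HarnessLib

/-!
# `Pialt` (crux stmt-ResolutionOfSingularities-0555), line `SketchIdeator2` / Card A: the Frobenius sandwich

Helper file for the OPEN stub `stub_tameResolution` (`TameResolution_p`) of the lead's skeleton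
`radicially-regular-endgame` (`--supports stmt-ResolutionOfSingularities-0555`; it does not close
the item). Step V2 of `Cruxes/Pialt/STUB-PLAN-stub_tameResolution.md` — the one new piece of
commutative algebra of the valuative reduction ("tame local uniformization on `K` itself").

**Setting.** `k ⊆ K ⊆ L` fields, `char k = p`, `L/K` purely inseparable (every `x ∈ L` has
some `x^{pⁿ} ∈ K`), `B ⊆ L` a finitely generated `k`-subalgebra, `T := B ∩ K` (the `comap` of
`B` along `K → L`).

* `fg_comap_toAlgHom` — **`T = B ∩ K` is finitely generated over `k`.** With generators
  `s₁, …, sₘ` of `B` and `sᵢ^{qᵢ} ∈ K`, the subalgebra `R := k[s₁^{q₁}, …, sₘ^{qₘ}] ⊆ T` is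
  Noetherian and `B = R[s₁, …, sₘ]` is a finite `R`-module (each `sᵢ` is integral over `R`);
  so the `R`-submodule `T ⊆ B` is finitely generated, and `T = k[sᵢ^{qᵢ}, t₁, …, tᵣ]`.
* `isFractionRing_comap_toAlgHom` — **`Frac T = K`** if `Frac B = L`: `z ∈ K` is `a/b` with
  `a, b ∈ B`, and `b^q ∈ K` for some `q = pⁿ ≥ 1`, so `z = (z b^q)/b^q` with
  `z b^q = a b^{q-1} ∈ B ∩ K` and `b^q ∈ B ∩ K`.
* `rr_spec_comap_toAlgHom` — **`Spec B → Spec T` is finite, universally injective and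
  surjective**; hence if `Spec B` is regular then `Spec T` is radicially regular (RR). The ring
  map `T → B` is injective, integral (`b^{pⁿ} ∈ T`) and of finite type, hence finite; radicial
  by `universallyInjective_specMap_of_pow_mem`; surjective on spectra by lying-over.

No perfectness of `k` and no normality of `B` is needed (the plan's `T = ` integral closure of
`B^q` in `K` is bypassed). Consumed by V3: Temkin's inseparable local uniformization on a finite
purely inseparable `L ⊇ K` yields a regular affine model `B ⊆ L°` of `L`, whence the RR affine
model `B ∩ K ⊆ L° ∩ K = K°` of `K` — tame local uniformization WITHOUT extending `K`.
-/

set_option linter.dupNamespace false -- mandated namespace of this single-conjunct summit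

noncomputable section

open CategoryTheory AlgebraicGeometry
open Literature.AlgebraicGeometry.Resolution

namespace Summit.ResolutionOfSingularities.ResolutionOfSingularities.Theorems.Pialt.RadiciallyRegular

/-- In a purely inseparable extension `L/K` in characteristic `p`, every element of `L` has a
`pⁿ`-th power in `K` (Mathlib `IsPurelyInseparable.pow_mem`, along the `k`-algebra map
`K → L`). [folklore] -/
theorem exists_toAlgHom_eq_pow (k K : Type) {L : Type} [Field k] [Field K] [Field L] [Algebra k K]
    [Algebra K L] [Algebra k L] [IsScalarTower k K L] [IsPurelyInseparable K L] (p : ℕ)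
    [Fact p.Prime] [CharP k p] (x : L) :
    ∃ (n : ℕ) (y : K), IsScalarTower.toAlgHom k K L y = x ^ p ^ n := by
  haveI : CharP K p := charP_of_injective_algebraMap (algebraMap k K).injective p
  haveI : ExpChar K p := ExpChar.prime Fact.out
  obtain ⟨n, y, hy⟩ := IsPurelyInseparable.pow_mem K p x
  exact ⟨n, y, hy⟩

/-- **`B ∩ K` is finitely generated.** For a finitely generated `k`-subalgebra `B` of `L`, `L/K`
purely inseparable of characteristic `p`, the `k`-subalgebra `B ∩ K` of `K` (`B.comap (K → L)`)
is finitely generated: with generators `sᵢ` of `B` and `sᵢ^{qᵢ} ∈ K`, `R := k[sᵢ^{qᵢ}] ⊆ B ∩ K`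
is Noetherian, `B = R[sᵢ]` is a finite `R`-module, so the `R`-submodule `B ∩ K` is finitely
generated, and `B ∩ K = k[sᵢ^{qᵢ}, t₁, …, tᵣ]`. [folklore] -/
theorem fg_comap_toAlgHom {k K L : Type} [Field k] [Field K] [Field L] [Algebra k K]
    [Algebra K L] [Algebra k L] [IsScalarTower k K L] [IsPurelyInseparable K L] (p : ℕ)
    [Fact p.Prime] [CharP k p] (B : Subalgebra k L) (hB : B.FG) :
    (B.comap (IsScalarTower.toAlgHom k K L)).FG := by
  classical
  set f := IsScalarTower.toAlgHom k K L with hf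
  have hfinj : Function.Injective f := (algebraMap K L).injective
  -- it suffices that `B ⊓ f.range`, the image of the comap, is finitely generated
  suffices h : (B ⊓ f.range).FG by
    refine Subalgebra.fg_of_fg_map _ f hfinj ?_
    rwa [Subalgebra.map_comap_eq]
  obtain ⟨s, hs⟩ := hB
  -- `p`-power exponents taking `L` into `K`
  choose n y hy using fun x : L => exists_toAlgHom_eq_pow k K p x
  -- `R := k[x ^ p ^ (n x) : x ∈ s] ⊆ B ⊓ f.range`
  set S₀ : Finset L := s.image fun x => x ^ p ^ n x with hS₀
  set R : Subalgebra k L := Algebra.adjoin k (S₀ : Set L) with hR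
  have hRle : R ≤ B ⊓ f.range := by
    refine Algebra.adjoin_le ?_
    intro z hz
    obtain ⟨x, hx, rfl⟩ := Finset.mem_image.mp (Finset.mem_coe.mp hz)
    refine ⟨?_, ?_⟩
    · exact pow_mem (hs ▸ Algebra.subset_adjoin (Finset.mem_coe.mpr hx)) _
    · exact ⟨y x, hy x⟩
  haveI : Algebra.FiniteType k R := (Subalgebra.fg_iff_finiteType R).mp ⟨S₀, rfl⟩
  haveI : IsNoetherianRing R := Algebra.FiniteType.isNoetherianRing k R
  -- `B' := R[s]` has finitely generated underlying `R`-module and contains `B`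
  set B' : Subalgebra R L := Algebra.adjoin R (s : Set L) with hB'
  have hB'fg : (Subalgebra.toSubmodule B').FG := by
    refine fg_adjoin_of_finite s.finite_toSet fun x hx => ?_
    have hxR : x ^ p ^ n x ∈ R := by
      refine Algebra.subset_adjoin ?_
      rw [hS₀, Finset.coe_image]
      exact Set.mem_image_of_mem _ (Finset.mem_coe.mpr hx)
    refine IsIntegral.of_pow (x := x) (n := p ^ n x) (pow_pos (Fact.out : p.Prime).pos _) ?_
    exact isIntegral_algebraMap (R := R) (A := L) (x := ⟨x ^ p ^ n x, hxR⟩)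
  have hBB' : (B : Set L) ⊆ B' := by
    rw [← hs]
    change ((Algebra.adjoin k (s : Set L) : Subalgebra k L) : Set L) ⊆
      (B'.restrictScalars k : Set L)
    exact Algebra.adjoin_le (Algebra.subset_adjoin (R := R) (s := (s : Set L)))
  -- `B ⊓ f.range` as an `R`-submodule of `L`, inside `B'`
  let TR : Submodule R L :=
    { carrier := ((B ⊓ f.range : Subalgebra k L) : Set L)
      add_mem' := fun ha hb => add_mem ha hb
      zero_mem' := zero_mem _
      smul_mem' := fun r a ha => mul_mem (hRle r.2) ha }
  have hTR : TR ≤ Subalgebra.toSubmodule B' := fun a ha => hBB' ha.1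
  haveI : Module.Finite R (Subalgebra.toSubmodule B') := Module.Finite.iff_fg.mpr hB'fg
  haveI hTfin : Module.Finite R TR :=
    Module.Finite.of_injective (Submodule.inclusion hTR) (Submodule.inclusion_injective hTR)
  -- finitely many `R`-module generators `t` of `B ⊓ f.range`
  obtain ⟨t, ht⟩ := hTfin.fg_top
  let t' : Finset L := t.image TR.subtype
  refine ⟨S₀ ∪ t', le_antisymm ?_ ?_⟩
  · -- `k[S₀ ∪ t'] ≤ B ⊓ f.range`
    refine Algebra.adjoin_le ?_
    intro z hz
    rcases Finset.mem_union.mp (Finset.mem_coe.mp hz) with hz | hz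
    · exact hRle (Algebra.subset_adjoin (Finset.mem_coe.mpr hz))
    · obtain ⟨a, -, rfl⟩ := Finset.mem_image.mp hz
      exact a.2
  · -- `B ⊓ f.range ≤ k[S₀ ∪ t']`
    intro z hz
    set A := Algebra.adjoin k ((S₀ ∪ t' : Finset L) : Set L) with hA
    have hRA : R ≤ A := Algebra.adjoin_mono fun w hw =>
      Finset.mem_coe.mpr (Finset.mem_union_left _ (Finset.mem_coe.mp hw))
    -- `A` as an `R`-submodule
    let AR : Submodule R L :=
      { carrier := (A : Set L)
        add_mem' := fun ha hb => add_mem ha hb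
        zero_mem' := zero_mem _
        smul_mem' := fun r a ha => mul_mem (hRA r.2) ha }
    have ht'A : ((t' : Finset L) : Set L) ⊆ AR := fun w hw =>
      Algebra.subset_adjoin (Finset.mem_coe.mpr (Finset.mem_union_right _ (Finset.mem_coe.mp hw)))
    have hz' : (⟨z, hz⟩ : TR) ∈ Submodule.span R (t : Set TR) := by
      rw [ht]
      trivial
    have hzspan : z ∈ Submodule.span R ((t' : Finset L) : Set L) := by
      have h1 := Submodule.apply_mem_span_image_of_mem_span TR.subtype hz'
      have h2 : (TR.subtype : TR → L) '' (t : Set TR) = ((t' : Finset L) : Set L) :=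
        (Finset.coe_image).symm
      rw [h2] at h1
      exact h1
    exact (Submodule.span_le.mpr ht'A) hzspan

/-- **`Frac (B ∩ K) = K`** when `Frac B = L` and `L/K` is purely inseparable of characteristic
`p`: `z ∈ K` is `a / b` in `L` with `a, b ∈ B`, `b ≠ 0`; for `q = pⁿ ≥ 1` with `b^q ∈ K` one has
`z = (z b^q) / b^q` with `z b^q = a b^{q-1} ∈ B ∩ K` and `b^q ∈ B ∩ K`. [folklore] -/
theorem isFractionRing_comap_toAlgHom {k K L : Type} [Field k] [Field K] [Field L] [Algebra k K]
    [Algebra K L] [Algebra k L] [IsScalarTower k K L] [IsPurelyInseparable K L] (p : ℕ)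
    [Fact p.Prime] [CharP k p] (B : Subalgebra k L) [IsFractionRing B L] :
    IsFractionRing (B.comap (IsScalarTower.toAlgHom k K L)) K := by
  set f := IsScalarTower.toAlgHom k K L with hf
  set T := B.comap f with hT
  refine IsFractionRing.of_field T K fun z => ?_
  obtain ⟨a, b, hb, hab⟩ := IsFractionRing.div_surjective (A := B) (f z)
  have hb0 : ((b : B) : L) ≠ 0 := by
    have : (b : B) ≠ 0 := nonZeroDivisors.ne_zero hb
    exact fun h => this (Subtype.ext h)
  obtain ⟨m, y, hy⟩ := exists_toAlgHom_eq_pow k K p ((b : B) : L)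
  obtain ⟨r, hr⟩ : ∃ r : ℕ, p ^ m = r + 1 :=
    ⟨p ^ m - 1, (Nat.sub_add_cancel (Nat.one_le_pow m p (Fact.out : p.Prime).pos)).symm⟩
  have hyT : y ∈ T := by
    change f y ∈ B
    rw [hy]
    exact pow_mem b.2 _
  have hzyT : z * y ∈ T := by
    change f (z * y) ∈ B
    rw [map_mul, hy, ← hab, hr, pow_succ]
    have : (algebraMap B L a / algebraMap B L b) * (((b : B) : L) ^ r * ((b : B) : L)) =
        (a : L) * ((b : B) : L) ^ r := by
      change ((a : L) / ((b : B) : L)) * _ = _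
      rw [mul_comm (((b : B) : L) ^ r) ((b : B) : L), ← mul_assoc, div_mul_cancel₀ _ hb0]
    rw [this]
    exact mul_mem a.2 (pow_mem b.2 _)
  have hy0 : y ≠ 0 := by
    intro h
    rw [h, map_zero] at hy
    exact pow_ne_zero _ hb0 hy.symm
  refine ⟨⟨z * y, hzyT⟩, ⟨y, hyT⟩, ?_⟩
  change z = (z * y) / y
  rw [mul_div_cancel_right₀ z hy0]

/-- **The Frobenius sandwich: `Spec B → Spec (B ∩ K)` is finite, universally injective and
surjective.** For `k ⊆ K ⊆ L` fields of characteristic `p` with `L/K` purely inseparable and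
`B ⊆ L` a finitely generated `k`-subalgebra, the restriction `B ∩ K → B` of `K → L` is injective,
integral (`b^{pⁿ} ∈ B ∩ K`) and of finite type (as `B` is over `k`), hence finite; it is
radicial (`universallyInjective_specMap_of_pow_mem`) and, by lying-over, surjective on spectra.
Consequently, if `Spec B` is regular then `Spec (B ∩ K)` is radicially regular. [folklore] -/
theorem rr_spec_comap_toAlgHom {k K L : Type} [Field k] [Field K] [Field L] [Algebra k K]
    [Algebra K L] [Algebra k L] [IsScalarTower k K L] [IsPurelyInseparable K L] (p : ℕ)
    [Fact p.Prime] [CharP k p] (B : Subalgebra k L) (hB : B.FG)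
    (hreg : Scheme.IsRegular (Spec (.of B))) :
    ∃ (W : Scheme.{0}) (h : W ⟶ Spec (.of (B.comap (IsScalarTower.toAlgHom k K L)))),
      IsIntegral W ∧ Scheme.IsRegular W ∧ IsFinite h ∧ UniversallyInjective h ∧
        Function.Surjective h.base := by
  set f := IsScalarTower.toAlgHom k K L with hf
  set T := B.comap f with hT
  -- the ring map `φ : T → B`, `t ↦ f t`
  let φ : T →ₐ[k] B := (f.comp T.val).codRestrict B fun t => t.2
  have hφ : ∀ t : T, ((φ t : B) : L) = f t := fun t => rfl
  have hφinj : Function.Injective φ := by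
    intro t₁ t₂ h
    have h' : f t₁ = f t₂ := by rw [← hφ, ← hφ, h]
    exact Subtype.ext ((algebraMap K L).injective h')
  -- every `b ∈ B` has a `pⁿ`-th power in the image of `φ`
  have hpow : ∀ b : B, ∃ (n : ℕ) (t : T), φ t = b ^ p ^ n := by
    intro b
    obtain ⟨n, y, hy⟩ := exists_toAlgHom_eq_pow k K p (b : L)
    have hyT : y ∈ T := by
      change f y ∈ B
      rw [hy]
      exact pow_mem b.2 _
    refine ⟨n, ⟨y, hyT⟩, Subtype.ext ?_⟩
    rw [hφ, SubmonoidClass.coe_pow]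
    exact hy
  -- `φ` is integral and of finite type, hence finite
  have hint : φ.toRingHom.IsIntegral := by
    letI : Algebra T B := φ.toRingHom.toAlgebra
    intro b
    obtain ⟨n, t, ht⟩ := hpow b
    have h1 : IsIntegral T (b ^ p ^ n) := by
      rw [← ht]
      exact isIntegral_algebraMap (R := T) (A := B) (x := t)
    exact IsIntegral.of_pow (pow_pos (Fact.out : p.Prime).pos n) h1
  have hft : φ.toRingHom.FiniteType := by
    have h0 : φ.toRingHom.comp (algebraMap k T) = algebraMap k B := φ.comp_algebraMap
    have h1 : (φ.toRingHom.comp (algebraMap k T)).FiniteType := by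
      rw [h0]
      exact RingHom.finiteType_algebraMap.mpr ((Subalgebra.fg_iff_finiteType B).mp hB)
    exact RingHom.FiniteType.of_comp_finiteType h1
  have hfin : φ.toRingHom.Finite :=
    RingHom.finite_iff_isIntegral_and_finiteType.mpr ⟨hint, hft⟩
  refine ⟨Spec (.of B), Spec.map (CommRingCat.ofHom φ.toRingHom), inferInstance, hreg,
    (IsFinite.SpecMap_iff _).mpr hfin, ?_, ?_⟩
  · -- radicial
    haveI : CharP T p := charP_of_injective_algebraMap (algebraMap k T).injective p
    exact universallyInjective_specMap_of_pow_mem φ.toRingHom p hpow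
  · -- surjective: lying over for the injective integral `φ`
    intro x
    obtain ⟨y, hy⟩ := hint.comap_surjective hφinj x
    exact ⟨y, hy⟩

end Summit.ResolutionOfSingularities.ResolutionOfSingularities.Theorems.Pialt.RadiciallyRegular

end
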